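import Summits.CriticalPhenomena.PercolationContinuityZ3.Theorems.PercNearOneGluingNoHeavyRsw3AnnulusTwoArmFarDichotomy
import Summits.CriticalPhenomena.PercolationContinuityZ3.Theorems.PercNearOneGluingNoHeavyRsw3AnnulusTwoArmFarCells
import HarnessLib

/-!
# RSW3 lane (P2, gen 14): the far two-arm bound at EVERY aspect `t`, at one of the two scales `N`, `⌊N/⌊t/2⌋⌋`, with ONE separation ball `Λ(jN)`

builds on p205010 (kernel theorem, internal audit signed; external expert review pending)

Cell `prim-rsw3`, prover seat `prim-rsw3-p2` (gen 14), memo `run/shared/lean/prim/rsw3/P2-RSWLITE.md` §21.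
Support file (`--supports stmt-CriticalPhenomena-4575`); no definitions, no named facts, no sorries.

The far form of gen 13's two-scale theorem (`exists_le_max_annulusTwoArmProb_criticalProbI_odd`).  With
`far(m, M, L) = {∃ x y ∈ Λ(m): x ↔ ∂ⁱⁿΛ(M) in Λ(M), y ↔ ∂ⁱⁿΛ(M) in Λ(M), x ↮ y in Λ(L)}` (inline) and `T = 2s + 1`:

  `exists_le_max_real_far_criticalProbI_odd`:  `∀ s ≥ 1, ∀ j ≥ 2s+1, ∃ c > 0, ∀ N ≥ 1, c ≤ max (P_{p_c}(far(N, TN, jN))) (P_{p_c}(far(⌊N/s⌋, T⌊N/s⌋, jN)))`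

— at every scale `N`, at scale `N` or at scale `⌊N/s⌋` two clusters cross the aspect-`T` annulus and are NOT joined inside the SAME ball `Λ(jN)`; every integer
aspect `t ≥ 3` via `T = 2⌊t/2⌋ + 1` (`exists_le_max_real_far_criticalProbI_aspect`).  For `s = 1` this is `exists_le_real_far_criticalProbI` (`…FarCritical`).
Proof: if both are small, the first gives near-certain thin-way crossings of the wide blocks `(2N; 2jN, 2jN)` (far sponge dichotomy at `(N, TN, jN)`,
`σ_loc(N,TN) ≥ c_s`), hence patch plates of length `2N` (square-root trick, `k = 8sj`); the second makes the far zones `FZ(z; ρ, Tρ, jN)`, `ρ = ⌊N/s⌋`, near-certain;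
the plates traverse `Λ_z(Tρ) ∖ Λ_z(ρ)` (`Tρ ≤ 2N + ρ`) and are glued inside `Λ_z(jN)` (footprint `jN ≤ k(m+1)`); `θ(p_c) > 0`, contradiction (p205010).

References: M. Aizenman, Nucl. Phys. B 485 (1997), §2 Thm. 2, Remark 2 [Aizenman1997]; S. Martineau, V. Tassion, Ann. Probab. 45 (2017), §3 [MartineauTassion2017];
H. Duminil-Copin, G. Kozma, V. Tassion, Progr. Probab. 77 (2020), §1.1 [DuminilcopinKozmaTassion2020]; G. Grimmett, *Percolation* (1999), (11.14), §7.4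
[GrimmettPercolation1999]. [folklore]
-/

noncomputable section

namespace Summit.CriticalPhenomena.PercolationContinuityZ3.Theorems.Rsw3

open MeasureTheory Literature.Probability.LatticeModels Literature.Probability.Percolation
open Literature.Probability.Percolation.KestenZhang Literature.Probability.Percolation.KozmaNitzan SimpleGraph Relation
open Summit.CriticalPhenomena.PercolationContinuityZ3.Theorems.Crossing SurfaceTension

/-- **Far two-arm bound at odd aspect `T = 2s+1`, at one of the two scales `N`, `⌊N/s⌋`, separation inside the same ball `Λ(jN)` (`p_c(ℤ³)`).**
For every `s ≥ 1` and `j ≥ 2s+1` there is `c > 0` with `c ≤ max (P_{p_c}(far(N, TN, jN))) (P_{p_c}(far(⌊N/s⌋, T⌊N/s⌋, jN)))` for every `N ≥ 1`.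
builds on p205010 (kernel theorem, internal audit signed; external expert review pending). [cite: Aizenman1997, §2 Thm. 2 and Remark 2] [cite: MartineauTassion2017, §3] -/
theorem exists_le_max_real_far_criticalProbI_odd (s : ℕ) (hs : 1 ≤ s) (j : ℕ) (hj : 2 * s + 1 ≤ j) :
    ∃ c : ℝ, 0 < c ∧ ∀ N : ℕ, 1 ≤ N →
      c ≤ max
        ((bondPercolation (zdGraph 3) (criticalProbI 3)).real
          {ω : BondConfig (Site 3) | ∃ x ∈ box 3 N, ∃ y ∈ box 3 N, ω ∈ toBdry ((2 * s + 1) * N) x ∧ ω ∈ toBdry ((2 * s + 1) * N) y ∧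
            ω ∉ openConnIn (↑(box 3 (j * N)) : Set (Site 3)) x y})
        ((bondPercolation (zdGraph 3) (criticalProbI 3)).real
          {ω : BondConfig (Site 3) | ∃ x ∈ box 3 (N / s), ∃ y ∈ box 3 (N / s), ω ∈ toBdry ((2 * s + 1) * (N / s)) x ∧
            ω ∈ toBdry ((2 * s + 1) * (N / s)) y ∧ ω ∉ openConnIn (↑(box 3 (j * N)) : Set (Site 3)) x y}) := by
  classical
  -- adapted from `exists_le_max_annulusTwoArmProb_criticalProbI_odd` (gen 13): far dichotomy, far zones, one separation ball `Λ(jN)`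
  set pc : unitInterval := criticalProbI 3 with hpc
  set μ := bondPercolation (zdGraph 3) pc with hμ
  set T : ℕ := 2 * s + 1 with hT
  obtain ⟨cl, hcl, hrad⟩ := exists_le_real_linked_radial_criticalProbI s hs
  set k : ℕ := 8 * s * j with hk
  have hk1 : 1 ≤ k := by rw [hk]; nlinarith
  set δ : ℝ := 1 / (2 * ((2 * (k : ℝ) + 1) ^ 2 + 2) * (2 * (3 ^ 2 + 1 : ℝ) ^ 2) ^ ((2 * k + 1) ^ 2)) with hδ
  set Δ : ℝ := δ ^ ((2 * k + 1) ^ 2) with hΔ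
  have hΔpos : 0 < Δ := by rw [hΔ, hδ]; positivity
  set η : ℝ := Δ / 2 with hη
  have hηpos : 0 < η := by rw [hη]; positivity
  have hpc1 : (pc : ℝ) < 1 := by rw [hpc, coe_criticalProbI]; exact criticalProb_zd_lt_one (d := 3) (by norm_num)
  set cs : ℝ := cl ^ 2 * (1 - (pc : ℝ)) ^ ((2 * (j * (6 * s)) + 1) ^ 6) with hcs
  have hcspos : 0 < cs := by
    rw [hcs]
    have : 0 < 1 - (pc : ℝ) := by linarith
    positivity
  refine ⟨min (min η (cl ^ 2 * η ^ (k ^ 2))) cs, lt_min (lt_min hηpos (by positivity)) hcspos, fun N hN => ?_⟩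
  have hTN : N + 1 ≤ T * N := by rw [hT]; nlinarith
  have hTj : T * N ≤ j * N := Nat.mul_le_mul_right N (by rw [hT]; exact hj)
  by_cases hsmall : N < 6 * s
  · -- small scales: positivity
    refine (min_le_right _ _).trans (le_trans ?_ (le_max_left _ _))
    have hpos := real_loc_sq_mul_one_sub_pow_le_real_far pc (n := N) (M := T * N) (L := j * N) hN hTN hTj
    refine le_trans ?_ hpos
    have h1 := hrad N hN
    rw [← hT] at h1
    rw [← hμ] at h1 ⊢
    have hp0 : 0 ≤ 1 - (pc : ℝ) := by linarith
    have hp1 : 1 - (pc : ℝ) ≤ 1 := by linarith [pc.2.1]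
    have hexp : (2 * (j * N) + 1) ^ 6 ≤ (2 * (j * (6 * s)) + 1) ^ 6 := by
      apply Nat.pow_le_pow_left
      have : j * N ≤ j * (6 * s) := Nat.mul_le_mul_left j hsmall.le
      omega
    have hpw : (1 - (pc : ℝ)) ^ ((2 * (j * (6 * s)) + 1) ^ 6) ≤ (1 - (pc : ℝ)) ^ ((2 * (j * N) + 1) ^ 6) :=
      pow_le_pow_of_le_one hp0 hp1 hexp
    have hσ2 : cl ^ 2 ≤ μ.real
        (linked (Set.Icc ![(N : ℤ), -((T * N : ℕ) : ℤ), -((T * N : ℕ) : ℤ)] ![((T * N : ℕ) : ℤ), ((T * N : ℕ) : ℤ), ((T * N : ℕ) : ℤ)])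
          (Set.Icc ![(N : ℤ), -(N : ℤ), -(N : ℤ)] ![(N : ℤ), (N : ℤ), (N : ℤ)])
          (Set.Icc ![((T * N : ℕ) : ℤ), -((T * N : ℕ) : ℤ), -((T * N : ℕ) : ℤ)] ![((T * N : ℕ) : ℤ), ((T * N : ℕ) : ℤ), ((T * N : ℕ) : ℤ)])) ^ 2 :=
      pow_le_pow_left₀ hcl.le h1 2
    rw [hcs]
    calc cl ^ 2 * (1 - (pc : ℝ)) ^ ((2 * (j * (6 * s)) + 1) ^ 6)
        ≤ cl ^ 2 * (1 - (pc : ℝ)) ^ ((2 * (j * N) + 1) ^ 6) := mul_le_mul_of_nonneg_left hpw (by positivity)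
      _ ≤ _ := mul_le_mul hσ2 le_rfl (by positivity) (sq_nonneg _)
  · -- large scales: the two-scale contradiction
    push Not at hsmall
    set ρ : ℕ := N / s with hρ
    set m : ℕ := (ρ - 1) / 2 with hm
    have hs0 : 0 < s := hs
    have hρs : s * ρ ≤ N := by rw [hρ, mul_comm]; exact Nat.div_mul_le_self N s
    have hρs' : N < s * ρ + s := by rw [hρ, mul_comm]; exact Nat.lt_div_mul_add hs0
    have hρ6 : 6 ≤ ρ := by rw [hρ]; exact (Nat.le_div_iff_mul_le hs0).2 (by linarith)
    have hm1 : 2 * m + 1 ≤ ρ := by omega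
    have hm2 : ρ ≤ 2 * m + 2 := by omega
    -- `k m ≥ 2 j N` and `j N ≤ k (m+1)`
    have h4sm : (4 : ℤ) * (s : ℤ) * (m : ℤ) ≥ (N : ℤ) := by
      have a : (2 : ℤ) * m ≥ (ρ : ℤ) - 2 := by
        have : ((ρ : ℕ) : ℤ) ≤ ((2 * m + 2 : ℕ) : ℤ) := by exact_mod_cast hm2
        push_cast at this
        linarith
      have b : (s : ℤ) * (ρ : ℤ) ≥ (N : ℤ) - s + 1 := by
        have h' : (N : ℤ) < (s : ℤ) * (ρ : ℤ) + (s : ℤ) := by exact_mod_cast hρs'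
        linarith
      have c : (N : ℤ) ≥ 6 * s := by exact_mod_cast hsmall
      have hs0' : (0 : ℤ) ≤ s := by positivity
      nlinarith [mul_le_mul_of_nonneg_left a hs0']
    have hkm : 2 * ((j * N : ℕ) : ℤ) ≤ (k : ℤ) * (m : ℤ) := by
      have e : (k : ℤ) * (m : ℤ) = 2 * (j : ℤ) * (4 * (s : ℤ) * (m : ℤ)) := by rw [hk]; push_cast; ring
      rw [e]; push_cast
      have hj0 : (0 : ℤ) ≤ j := by positivity
      nlinarith
    have hρN : ρ ≤ N := by rw [hρ]; exact Nat.div_le_self N s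
    have hLk : j * N ≤ k * (m + 1) := by
      have h1 : N ≤ s * (2 * m + 3) :=
        calc N ≤ s * ρ + s := hρs'.le
          _ ≤ s * (2 * m + 2) + s := by gcongr
          _ = s * (2 * m + 3) := by ring
      have h2 : s * (2 * m + 3) ≤ 8 * s * (m + 1) := by
        rw [show 8 * s * (m + 1) = s * (8 * (m + 1)) by ring]
        exact Nat.mul_le_mul_left s (by omega)
      calc j * N ≤ j * (8 * s * (m + 1)) := Nat.mul_le_mul_left j (h1.trans h2)
        _ = k * (m + 1) := by rw [hk]; ring
    have hP : T * ρ ≤ 2 * N + ρ := by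
      have h2 : 2 * (s * ρ) ≤ 2 * N := Nat.mul_le_mul_left 2 hρs
      calc T * ρ = 2 * (s * ρ) + ρ := by rw [hT]; ring
        _ ≤ 2 * N + ρ := Nat.add_le_add_right h2 ρ
    have hρR : ρ ≤ T * ρ := Nat.le_mul_of_pos_left ρ (by rw [hT]; omega)
    have hRL : T * ρ ≤ j * N :=
      calc T * ρ ≤ T * N := Nat.mul_le_mul_left T hρN
        _ ≤ j * N := hTj
    refine le_of_not_gt fun hlt => ?_
    have hlt' := lt_of_lt_of_le hlt (min_le_left _ _)
    have hfar1 : μ.real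
        {ω : BondConfig (Site 3) | ∃ x ∈ box 3 N, ∃ y ∈ box 3 N, ω ∈ toBdry (T * N) x ∧ ω ∈ toBdry (T * N) y ∧
          ω ∉ openConnIn (↑(box 3 (j * N)) : Set (Site 3)) x y} < cl ^ 2 * η ^ (k ^ 2) :=
      lt_of_le_of_lt (le_max_left _ _) (lt_of_lt_of_le hlt' (min_le_right _ _))
    have hfar2 : μ.real
        {ω : BondConfig (Site 3) | ∃ x ∈ box 3 ρ, ∃ y ∈ box 3 ρ, ω ∈ toBdry (T * ρ) x ∧ ω ∈ toBdry (T * ρ) y ∧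
          ω ∉ openConnIn (↑(box 3 (j * N)) : Set (Site 3)) x y} < η :=
      lt_of_le_of_lt (le_max_right _ _) (lt_of_lt_of_le hlt' (min_le_left _ _))
    -- (1) the far sponge dichotomy at `(N, TN, jN)`
    have hdich := real_loc_sq_mul_real_compl_boxCross_le_real_far pc (n := N) (M := T * N) (L := j * N) hN hTN hTj
    have hσ := hrad N hN
    rw [← hT] at hσ
    rw [← hμ] at hdich hσ
    have hσ2 : cl ^ 2 ≤ μ.real
        (linked (Set.Icc ![(N : ℤ), -((T * N : ℕ) : ℤ), -((T * N : ℕ) : ℤ)] ![((T * N : ℕ) : ℤ), ((T * N : ℕ) : ℤ), ((T * N : ℕ) : ℤ)])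
          (Set.Icc ![(N : ℤ), -(N : ℤ), -(N : ℤ)] ![(N : ℤ), (N : ℤ), (N : ℤ)])
          (Set.Icc ![((T * N : ℕ) : ℤ), -((T * N : ℕ) : ℤ), -((T * N : ℕ) : ℤ)] ![((T * N : ℕ) : ℤ), ((T * N : ℕ) : ℤ), ((T * N : ℕ) : ℤ)])) ^ 2 :=
      pow_le_pow_left₀ hcl.le hσ 2
    have hblock : μ.real (boxCross ![2 * (N : ℤ), 2 * ((j * N : ℕ) : ℤ), 2 * ((j * N : ℕ) : ℤ)] 0)ᶜ ≤ η ^ (k ^ 2) := by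
      by_contra hgt
      push Not at hgt
      have hcl2 : 0 < cl ^ 2 := by positivity
      have : cl ^ 2 * η ^ (k ^ 2) < μ.real
          {ω : BondConfig (Site 3) | ∃ x ∈ box 3 N, ∃ y ∈ box 3 N, ω ∈ toBdry (T * N) x ∧ ω ∈ toBdry (T * N) y ∧
            ω ∉ openConnIn (↑(box 3 (j * N)) : Set (Site 3)) x y} :=
        calc cl ^ 2 * η ^ (k ^ 2) < cl ^ 2 * μ.real (boxCross ![2 * (N : ℤ), 2 * ((j * N : ℕ) : ℤ), 2 * ((j * N : ℕ) : ℤ)] 0)ᶜ :=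
              mul_lt_mul_of_pos_left hgt hcl2
          _ ≤ _ := (mul_le_mul_of_nonneg_right hσ2 measureReal_nonneg).trans hdich
      linarith
    -- (2) the square-root step
    have hpatch := real_compl_patch_le_rpow pc (P := 2 * N) (m := m) (k := k) (W := 2 * ((j * N : ℕ) : ℤ)) hk1 hkm
    have e2N : (((2 * N : ℕ) : ℤ)) = 2 * (N : ℤ) := by push_cast; ring
    rw [e2N, ← hμ] at hpatch
    have hrpow : (μ.real (boxCross ![2 * (N : ℤ), 2 * ((j * N : ℕ) : ℤ), 2 * ((j * N : ℕ) : ℤ)] 0)ᶜ) ^ (((k : ℝ) ^ 2)⁻¹) ≤ η := by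
      have h1 : (μ.real (boxCross ![2 * (N : ℤ), 2 * ((j * N : ℕ) : ℤ), 2 * ((j * N : ℕ) : ℤ)] 0)ᶜ) ^ (((k : ℝ) ^ 2)⁻¹) ≤
          (η ^ (k ^ 2)) ^ (((k : ℝ) ^ 2)⁻¹) := Real.rpow_le_rpow measureReal_nonneg hblock (by positivity)
      have h2 : (η ^ (k ^ 2)) ^ (((k : ℝ) ^ 2)⁻¹) = η := by
        rw [show ((k : ℝ) ^ 2)⁻¹ = (((k ^ 2 : ℕ) : ℝ))⁻¹ by push_cast; ring]
        exact Real.pow_rpow_inv_natCast hηpos.le (by positivity)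
      exact h1.trans h2.le
    -- (3) the far criterion at `p_c`
    have hsum : μ.real
          (linked
            (↑(Finset.Icc (![(0 : ℤ), -(((k : ℤ) - 1) * m), -(((k : ℤ) - 1) * m)] : Site 3)
              ![((2 * N : ℕ) : ℤ), (k : ℤ) * m, (k : ℤ) * m]))
            (↑(Finset.Icc (0 : Site 3) ![((0 : ℕ) : ℤ), m, m]))
            (↑(Finset.Icc (![((2 * N : ℕ) : ℤ), -(((k : ℤ) - 1) * m), -(((k : ℤ) - 1) * m)] : Site 3)
              ![((2 * N : ℕ) : ℤ), (k : ℤ) * m, (k : ℤ) * m])))ᶜ +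
        μ.real
          {ω : BondConfig (Site 3) | ∃ x ∈ box 3 ρ, ∃ y ∈ box 3 ρ, ω ∈ toBdry (T * ρ) x ∧ ω ∈ toBdry (T * ρ) y ∧
            ω ∉ openConnIn (↑(box 3 (j * N)) : Set (Site 3)) x y} ≤ Δ := by
      have : η + η = Δ := by rw [hη]; exact add_halves _
      rw [e2N]
      exact (add_le_add (hpatch.trans hrpow) hfar2.le).trans this.le
    have hθ : 0 < theta (zdGraph 3) (0 : Site 3) pc :=
      theta_pos_of_src_farZone_criterion_sphere pc (m := m) (ρ := ρ) (R := T * ρ) (L := j * N) (P := 2 * N) (k := k)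
        hm1 hρR hRL hP hLk (by rw [← hμ, ← hδ, ← hΔ]; exact hsum)
    -- (4) contradiction with continuity
    have h0 : theta (zdGraph 3) (0 : Site 3) pc = 0 := CSH.percolationContinuity_allDimensions 3 (by norm_num)
    exact hθ.ne' h0

/-- **Every integer aspect `t ≥ 3`, at one of the two scales `N`, `⌊N/⌊t/2⌋⌋`, separation inside `Λ(jN)` for every `j ≥ t + 1`** (odd `T = 2⌊t/2⌋ + 1 ≥ t`
and monotonicity of the far event in the crossing radius, `real_far_anti`).  builds on p205010 (kernel theorem, internal audit signed; external expert review pending).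
[cite: Aizenman1997, §2 Remark 2] [cite: DuminilcopinKozmaTassion2020, §1.1 (bounded-ratio uniqueness zone)] -/
theorem exists_le_max_real_far_criticalProbI_aspect (t : ℕ) (ht : 3 ≤ t) (j : ℕ) (hj : t + 1 ≤ j) :
    ∃ c : ℝ, 0 < c ∧ ∀ N : ℕ, 1 ≤ N →
      c ≤ max
        ((bondPercolation (zdGraph 3) (criticalProbI 3)).real
          {ω : BondConfig (Site 3) | ∃ x ∈ box 3 N, ∃ y ∈ box 3 N, ω ∈ toBdry (t * N) x ∧ ω ∈ toBdry (t * N) y ∧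
            ω ∉ openConnIn (↑(box 3 (j * N)) : Set (Site 3)) x y})
        ((bondPercolation (zdGraph 3) (criticalProbI 3)).real
          {ω : BondConfig (Site 3) | ∃ x ∈ box 3 (N / (t / 2)), ∃ y ∈ box 3 (N / (t / 2)), ω ∈ toBdry (t * (N / (t / 2))) x ∧
            ω ∈ toBdry (t * (N / (t / 2))) y ∧ ω ∉ openConnIn (↑(box 3 (j * N)) : Set (Site 3)) x y}) := by
  set s : ℕ := t / 2 with hs
  have hs1 : 1 ≤ s := by rw [hs]; omega
  have hts : t ≤ 2 * s + 1 := by rw [hs]; omega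
  have hjT : 2 * s + 1 ≤ j := by rw [hs]; omega
  obtain ⟨c, hc, h⟩ := exists_le_max_real_far_criticalProbI_odd s hs1 j hjT
  refine ⟨c, hc, fun N hN => (h N hN).trans ?_⟩
  have ht1 : 1 ≤ t := by omega
  refine max_le_max ?_ ?_
  · exact real_far_anti (criticalProbI 3) le_rfl (Nat.le_mul_of_pos_left N (by omega)) (Nat.mul_le_mul_right N hts) le_rfl
  · exact real_far_anti (criticalProbI 3) le_rfl (Nat.le_mul_of_pos_left _ (by omega)) (Nat.mul_le_mul_right _ hts) le_rfl

end Summit.CriticalPhenomena.PercolationContinuityZ3.Theorems.Rsw3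

end
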